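import Summits.ABC.IUTFork.Repair.RHRealisableMassSlotLinear
import Summits.ABC.IUTFork.Repair.RHHullCellSlice
import HarnessLib

/-!
# R-H ROUND-3 AXIS D2, class «SRM» (slope-recoverable mass): THE RECOVERED FRACTION HAS HEIGHT EXPONENT −1 — per place the SRM object
# saturates at the height-free price sum `Σ_{j=2}^{L} (j·δ + (j+1)·G + ρ_j)` while the trivial mass grows linearly in the local height

PROOF-ONLY file (0 definitions, 0 `Prop` facts, no instance, no notation) of the abc-iut cell, rung LADDER-ABC:A2.RESCUE.H, seat
abc-iut-rh2-q2-eq (gen 8), KEY `D2-EXP-2` of the round-3 AXES C/D desk (abc-iut-rh-lead g4, `plan/rescue/R-H/ROUND3/AXIS-CD-DESK.md` §D2;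
21-frontier D-0127 / D-0130): «for the object class SRM derive the recovered-fraction EXPONENT in the height from the FINAL's item (1)(d)
law (credit conductor-type while `T ∝ h`), with the bed as witness; kernel face where decidable». This is the kernel face, in the INTEGER
cell currency of abc-iut-rh2-w-2's `RHHullCellSlice` (p480472) and this seat's `RHRealisableMassSlotLinear` (p495443, law N12).

THE INTEGERS (one packet at one place `w`, all of `ℤ`; R-W / R-H table columns): ramification `e ≥ 1`, local `q`-height `m = m_q(w)`
(HEIGHT SCALING of D-0121 item (1)(e) is `m ↦ s·m` at fixed `e, δ, R_in, R_out, L`), different exponent `δ ≥ 0`, log-shell radii exponents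
`R_out ≤ R_in` (`G := R_in − R_out`), labels `j = 1 … L` (`L = l⋆`). At label `j`: threshold `thr_j(m) := e·⌊(j²m − jδ − (j+1)R_in)/e⌋ + (j+1)R_out`,
DEFICIT `d_j(m) := thr_j(m) − m` (licensed iff `d_j ≤ 0`; rows 3/4 of R-H round 2, `sigmaNu = licenceCells` p470233 read through
`orders_iff_hullCellδ` p484893), TRIVIAL MASS `t_j(m) := (j²−1)·m`, RESIDUE `ρ_j(m) := (j²m − jδ − (j+1)R_in) mod e ∈ [0, e−1]`.
THE SRM OBJECT (D-0121 FINAL 12:00Z item (4), «SRM := Σ_{cells c, j_c > j₀} m_c·κ_cov(c)», identity «the covered part of a cell above j₀ is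
m_c − def_c = j²·m_q − thr_j») keeps, at every UNLICENSED cell, its covered part `t_j − d_j`; written here cell by cell as
`srmCell_j(m) := if 0 < d_j(m) then t_j(m) − d_j(m) else 0` and per place `SRM_L(m) := Σ_{j=1}^{L} srmCell_j(m)` (as a `Finset.range` sum over
`k`, `j = k+1`); the place's trivial mass is `MASS_L(m) := Σ_{j=1}^{L} (j²−1)·m`. (At the bed the licensed cells of a place form an initial
segment `{1,…,J_w}` — `HullCellSlice.exists_sliceBoundary` — so «`j > j₀`» and «unlicensed» are the same cells; the cellwise form needs no slice.)

WHAT IS PROVED (namespace `Summit.ABC.IUTFork.Repair.RH.HeightScalingSRM`; hypotheses `0 < e`, `0 ≤ δ`, `R_out ≤ R_in` are structural facts of a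
local field, [SerreLocalFields1979] III §6 Prop. 13 and `𝔪^{R_in} ⊆ log(𝒪^×) ⊆ 𝔪^{R_out}`):
* §1 PER CELL. `covered_eq` «`t_j(m) − d_j(m) = j·δ + (j+1)·G + ρ_j(m)` for ALL integers» — the covered part of a cell is HEIGHT-FREE up to the
  residue (the identity `e·⌊X/e⌋ = X − X mod e`); `srmCell_nonneg`, `srmCell_le_price` (`≤ jδ + (j+1)G + (e−1)`); `deficit_one_nonpos` (label 1 is
  licensed at EVERY height, so it never carries SRM); **`deficit_pos_of_saturated`** «`2 ≤ j ∧ 2δ + 3G + e ≤ 3m ⟹ 0 < d_j(m)`» (beyond the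
  SATURATION HEIGHT `m_sat := ⌈(2δ + 3G + e)/3⌉` every label `j ≥ 2` is unlicensed: `(j²−1)·3m ≥ (j²−1)(2δ+3G+e) ≥ 3(jδ + (j+1)G + (e−1)) + 3`).
* §2 PER PLACE. `six_mul_sum_range_price` (closed form `6·Σ_{k<n}((k+2)δ + (k+3)G) = 3n(n+3)δ + 3n(n+5)G`); **`srm_le`** «at EVERY height
  `6·SRM_{n+1}(m) ≤ 3n(n+3)·δ + 3n(n+5)·G + 6n·(e−1)`» (a conductor-type, height-free ceiling: the total price of the labels `2 … n+1`);
  **`srm_eq_of_saturated`** «`2δ + 3G + e ≤ 3m ⟹ SRM_{n+1}(m) = Σ_{k<n} ((k+2)δ + (k+3)G + ρ_{k+2}(m))` EXACTLY» with the two-sided bracket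
  **`le_srm_of_saturated`** / `srm_le` «`3n(n+3)δ + 3n(n+5)G ≤ 6·SRM_{n+1}(m) ≤ 3n(n+3)δ + 3n(n+5)G + 6n(e−1)`»; `six_mul_mass`
  «`6·MASS_{n+1}(m) = ((n+1)(n+2)(2n+3) − 6(n+1))·m`» (this seat's `six_mul_sum_range_demand`).
* §3 THE EXPONENT. **`srm_div_mass_le`** and **`le_srm_div_mass_of_saturated`** (over `ℚ`, `1 ≤ n`, `0 < m`): with `S := (n+1)(n+2)(2n+3) − 6(n+1)`,
  `A := 3n(n+3)δ + 3n(n+5)G`, `B := A + 6n(e−1)`: «`SRM/MASS ≤ B/(S·m)` at every height» and «`A/(S·m) ≤ SRM/MASS` beyond saturation» — the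
  recovered fraction of the SRM class at a place is `Θ(m⁻¹)` with EXPLICIT height-free constants: HEIGHT EXPONENT EXACTLY `−1` (not faster, not
  slower), constant `∈ [A/S, B/S]` in units of `m_q`; summed over places with print's weights `ln p/l⋆` and divided by `T(h) = M(h) − Tol` this is the
  desk's `f_SRM(h) = c_SRM·h⁻¹·(1 + o(1))` (D2-EXP-2 numbers of record: `ĉ = Π₂/M_bed` pooled 1.889 FREY133 · 3.676 HEX79 · 2.006 FREY482, fitted
  exponent −1.0000 on 133 + 79 + 482 data; HOME/abc-iut-rh2-q2-eq/D2/).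
* §4 BED WITNESS by `decide` (HEX `λ₈@l=11` K-line at `p = 7`: `e = 165`, `m_q = 120`, `δ = 164`, `R_in = 28`, `R_out = −281`, `L = 5`, the worked
  place of p495443 §4): at the bed `m = 120` only label 5 is unlicensed, `SRM = 2706`, `MASS = 6000`; saturation threshold `2δ + 3G + e = 1420 ≤ 3·480`
  (`s = 4`): `SRM(480) = 8208 ∈ [7858, 8514]`, `MASS = 24000`; at `s = 100` (`m = 12000`): `SRM = 8238`, `MASS = 600000` — the bracket `[7858, 8514]`
  holds at every height past `s = 4` while the mass grows linearly: ratio `0.451 → 0.342 → 0.0137`.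
READING (numbers elsewhere, not here): SRM is conductor-type exactly like the credit (FINAL (1)(d)/(e): `C/R ∝ h⁻¹`); its ceiling is the EX-tier
price sum less label 1. HONEST FRAMING: pure integer arithmetic of prescribed table columns; which genuine completion carries which
`(e, m, δ, R_in, R_out)` is the kit tables' audit (computed ≠ proved); height scaling `m ↦ s·m` is the WINDOW MODEL of D-0121 item (1)(e), not an
operation on genuine data; nothing here decides any cell at genuine data, asserts or denies [IUTchIII] Cor. 3.12 / [IUTchIV] Thm 1.10, or bears on
abc; no side taken on any author (Mochizuki / Scholze–Stix / Joshi / Dupuy–Hilado); typed ≠ proved for anything not named as a theorem.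
[cite: Mochizuki2012, IUTchIV Prop. 1.2 (i)(ii) p. 10, Prop. 1.4 (iii) p. 13–14, Thm. 1.10 Step (v) p. 27–28] [cite: SerreLocalFields1979, Ch. III §6 Prop. 13]
[cite: DupuyHilado2025, §4.9, §4.12] [claim: Mochizuki2012, status: disputed] for every quoted construction.
-/

namespace Summit.ABC.IUTFork.Repair.RH.HeightScalingSRM

open Summit.ABC.IUTFork.Repair.RH.RealisableMass Summit.ABC.IUTFork.Repair.RH.HullCellSlice

/-! ## §1. Per cell: the covered part is height-free up to the residue; label 1 never carries SRM; saturation -/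

/-- **The covered part of a cell is height-free up to the residue**: `t_j(m) − d_j(m) = j·δ + (j+1)·(R_in − R_out) + ρ_j(m)` with
`ρ_j(m) = (j²m − jδ − (j+1)R_in) mod e`, for ALL integers (the identity `e·⌊X/e⌋ = X − X mod e`). This is the FINAL's item-(4) identity
«the covered part of a cell above `j₀` is `m_c − def_c = j²·m_q − thr_j`» with `thr_j` unfolded. [folklore] -/
theorem covered_eq (m e δ Rin Rout j : ℤ) :
    (j ^ 2 - 1) * m - (e * ((j ^ 2 * m - j * δ - (j + 1) * Rin) / e) + (j + 1) * Rout - m) =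
      j * δ + (j + 1) * (Rin - Rout) + (j ^ 2 * m - j * δ - (j + 1) * Rin) % e := by
  have h := Int.mul_ediv_add_emod (j ^ 2 * m - j * δ - (j + 1) * Rin) e
  linarith

/-- The SRM cell term is non-negative (`0 < e`, `0 ≤ δ`, `R_out ≤ R_in`, `0 ≤ j`): an unlicensed cell's covered part is a price `≥ 0`. [folklore] -/
theorem srmCell_nonneg {m e δ Rin Rout j : ℤ} (he : 0 < e) (hδ : 0 ≤ δ) (hio : Rout ≤ Rin) (hj : 0 ≤ j) :
    0 ≤ (if 0 < e * ((j ^ 2 * m - j * δ - (j + 1) * Rin) / e) + (j + 1) * Rout - m then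
      (j ^ 2 - 1) * m - (e * ((j ^ 2 * m - j * δ - (j + 1) * Rin) / e) + (j + 1) * Rout - m) else 0) := by
  split_ifs with h
  · rw [covered_eq]
    have h0 := (gain_bounds he m j δ Rin).1
    have h1 : 0 ≤ j * δ := mul_nonneg hj hδ
    have h2 : 0 ≤ (j + 1) * (Rin - Rout) := mul_nonneg (by omega) (by omega)
    linarith
  · exact le_rfl

/-- **The SRM cell term is at most the slot-linear price** `j·δ + (j+1)·(R_in − R_out) + (e − 1)` (`0 < e`, `0 ≤ δ`, `R_out ≤ R_in`, `0 ≤ j`) —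
law N12 (p495443 `trivMass_sub_defplus_le`) read on the SRM object: what the object keeps at a cell is conductor-type, height-free.
[cite: DupuyHilado2025, §4.12] [claim: Mochizuki2012, status: disputed] -/
theorem srmCell_le_price {m e δ Rin Rout j : ℤ} (he : 0 < e) (hδ : 0 ≤ δ) (hio : Rout ≤ Rin) (hj : 0 ≤ j) :
    (if 0 < e * ((j ^ 2 * m - j * δ - (j + 1) * Rin) / e) + (j + 1) * Rout - m then
      (j ^ 2 - 1) * m - (e * ((j ^ 2 * m - j * δ - (j + 1) * Rin) / e) + (j + 1) * Rout - m) else 0)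
      ≤ j * δ + (j + 1) * (Rin - Rout) + (e - 1) := by
  split_ifs with h
  · rw [covered_eq]
    have h1 := (gain_bounds he m j δ Rin).2
    linarith
  · have h1 : 0 ≤ j * δ := mul_nonneg hj hδ
    have h2 : 0 ≤ (j + 1) * (Rin - Rout) := mul_nonneg (by omega) (by omega)
    linarith

/-- **Label 1 is licensed at EVERY height** (`0 < e`, `0 ≤ δ`, `R_out ≤ R_in`, any `m`): `d_1(m) = e·⌊(m − δ − 2R_in)/e⌋ + 2R_out − m ≤ −δ − 2G ≤ 0`.
So the SRM object never keeps anything at label 1 (whose trivial mass is `0` anyway), at any height. [folklore] -/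
theorem deficit_one_nonpos {m e δ Rin Rout : ℤ} (he : 0 < e) (hδ : 0 ≤ δ) (hio : Rout ≤ Rin) (j : ℤ) (hj : j = 1) :
    e * ((j ^ 2 * m - j * δ - (j + 1) * Rin) / e) + (j + 1) * Rout - m ≤ 0 := by
  subst hj
  have h1 := Int.mul_ediv_add_emod ((1 : ℤ) ^ 2 * m - 1 * δ - (1 + 1) * Rin) e
  have h2 := Int.emod_nonneg ((1 : ℤ) ^ 2 * m - 1 * δ - (1 + 1) * Rin) he.ne'
  nlinarith

/-- **SATURATION: beyond `m_sat` every label `j ≥ 2` is unlicensed.** If `2 ≤ j`, `0 < e`, `0 ≤ δ`, `R_out ≤ R_in` and `2δ + 3G + e ≤ 3m`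
(`G = R_in − R_out`), then `0 < d_j(m)`. Proof: `d_j ≥ (j²−1)m − (jδ + (j+1)G + (e−1))` (floor) and
`(j²−1)(2δ + 3G + e) − 3(jδ + (j+1)G + (e−1)) = (2j+1)(j−2)δ + 3(j+1)(j−2)G + (j²−4)e + 3 ≥ 3`. So as the height grows the licence boundary of
every place drops to label 1 and the whole off-label-1 price becomes SRM. [folklore] -/
theorem deficit_pos_of_saturated {m e δ Rin Rout j : ℤ} (he : 0 < e) (hδ : 0 ≤ δ) (hio : Rout ≤ Rin) (hj : 2 ≤ j)
    (hsat : 2 * δ + 3 * (Rin - Rout) + e ≤ 3 * m) :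
    0 < e * ((j ^ 2 * m - j * δ - (j + 1) * Rin) / e) + (j + 1) * Rout - m := by
  have hfl := mul_ediv_ge (j ^ 2 * m - j * δ - (j + 1) * Rin) e (by omega)
  have hG : 0 ≤ Rin - Rout := by omega
  have h1 : 0 ≤ (2 * j + 1) * (j - 2) * δ := mul_nonneg (mul_nonneg (by omega) (by omega)) hδ
  have h2 : 0 ≤ 3 * (j + 1) * (j - 2) * (Rin - Rout) := mul_nonneg (mul_nonneg (by positivity) (by omega)) hG
  have h3 : 0 ≤ (j ^ 2 - 4) * e := mul_nonneg (by nlinarith) he.le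
  have h4 : 0 ≤ j ^ 2 - 1 := by nlinarith
  have h5 : (j ^ 2 - 1) * (2 * δ + 3 * (Rin - Rout) + e) ≤ (j ^ 2 - 1) * (3 * m) := mul_le_mul_of_nonneg_left hsat h4
  nlinarith

/-! ## §2. Per place: the height-free ceiling at every height, the exact saturated value, the two-sided bracket, the mass -/

/-- Closed form of the off-label-1 price sum: `6·Σ_{k<n} ((k+2)·δ + (k+3)·G) = 3n(n+3)·δ + 3n(n+5)·G`. [folklore] -/
theorem six_mul_sum_range_price (δ G : ℤ) (n : ℕ) :
    6 * ∑ k ∈ Finset.range n, (((k : ℤ) + 2) * δ + ((k : ℤ) + 3) * G) =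
      3 * (n : ℤ) * (n + 3) * δ + 3 * (n : ℤ) * (n + 5) * G := by
  induction n with
  | zero => simp
  | succ n ih =>
    rw [Finset.sum_range_succ, mul_add, ih]
    push_cast
    ring

/-- **THE HEIGHT-FREE CEILING OF THE SRM OBJECT AT A PLACE, AT EVERY HEIGHT**: over the labels `1 … n+1`,
`6·SRM_{n+1}(m) ≤ 3n(n+3)·δ + 3n(n+5)·G + 6n·(e−1)` (`0 < e`, `0 ≤ δ`, `R_out ≤ R_in`; ANY `m`): label 1 contributes nothing
(`deficit_one_nonpos`) and label `j = k+2` at most its price (`srmCell_le_price`). The right side is conductor-type (different + log-shell +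
integral-structure slack), with NO height term — the SRM analogue of abc-iut-rh2-T-1's `cellCredit_diag_le_shellBudget` (p491053).
[cite: DupuyHilado2025, §4.12] [claim: Mochizuki2012, status: disputed] -/
theorem srm_le (m e δ Rin Rout : ℤ) (he : 0 < e) (hδ : 0 ≤ δ) (hio : Rout ≤ Rin) (n : ℕ) :
    6 * ∑ k ∈ Finset.range (n + 1),
        (if 0 < e * ((((k : ℤ) + 1) ^ 2 * m - ((k : ℤ) + 1) * δ - ((k : ℤ) + 1 + 1) * Rin) / e) + ((k : ℤ) + 1 + 1) * Rout - m then
          (((k : ℤ) + 1) ^ 2 - 1) * m -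
            (e * ((((k : ℤ) + 1) ^ 2 * m - ((k : ℤ) + 1) * δ - ((k : ℤ) + 1 + 1) * Rin) / e) + ((k : ℤ) + 1 + 1) * Rout - m)
        else 0)
      ≤ 3 * (n : ℤ) * (n + 3) * δ + 3 * (n : ℤ) * (n + 5) * (Rin - Rout) + 6 * (n : ℤ) * (e - 1) := by
  rw [Finset.sum_range_succ']
  -- label 1 (`k = 0`): licensed at every height, term `= 0`
  have h0 : ¬ (0 < e * (((((0 : ℕ) : ℤ) + 1) ^ 2 * m - (((0 : ℕ) : ℤ) + 1) * δ - (((0 : ℕ) : ℤ) + 1 + 1) * Rin) / e) + (((0 : ℕ) : ℤ) + 1 + 1) * Rout - m) :=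
    not_lt.mpr (deficit_one_nonpos he hδ hio (((0 : ℕ) : ℤ) + 1) (by norm_num))
  rw [if_neg h0, add_zero]
  -- labels `j = k + 2`, `k < n`: each term at most its price
  have hle : ∑ k ∈ Finset.range n,
      (if 0 < e * (((((k + 1 : ℕ) : ℤ) + 1) ^ 2 * m - (((k + 1 : ℕ) : ℤ) + 1) * δ - (((k + 1 : ℕ) : ℤ) + 1 + 1) * Rin) / e) + (((k + 1 : ℕ) : ℤ) + 1 + 1) * Rout - m then
          ((((k + 1 : ℕ) : ℤ) + 1) ^ 2 - 1) * m -
            (e * (((((k + 1 : ℕ) : ℤ) + 1) ^ 2 * m - (((k + 1 : ℕ) : ℤ) + 1) * δ - (((k + 1 : ℕ) : ℤ) + 1 + 1) * Rin) / e) + (((k + 1 : ℕ) : ℤ) + 1 + 1) * Rout - m)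
        else 0)
      ≤ ∑ k ∈ Finset.range n, (((k : ℤ) + 2) * δ + ((k : ℤ) + 3) * (Rin - Rout) + (e - 1)) := by
    apply Finset.sum_le_sum
    intro k _
    have h := srmCell_le_price (m := m) (Rout := Rout) he hδ hio (j := ((k + 1 : ℕ) : ℤ) + 1) (by positivity)
    have e1 : ((k + 1 : ℕ) : ℤ) + 1 = (k : ℤ) + 2 := by push_cast; ring
    have e2 : (k : ℤ) + 2 + 1 = (k : ℤ) + 3 := by ring
    rw [e1, e2] at h ⊢
    exact h
  have hcf := six_mul_sum_range_price δ (Rin - Rout) n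
  have hsplit : ∑ k ∈ Finset.range n, (((k : ℤ) + 2) * δ + ((k : ℤ) + 3) * (Rin - Rout) + (e - 1)) =
      ∑ k ∈ Finset.range n, (((k : ℤ) + 2) * δ + ((k : ℤ) + 3) * (Rin - Rout)) + (n : ℤ) * (e - 1) := by
    rw [Finset.sum_add_distrib, Finset.sum_const, Finset.card_range, nsmul_eq_mul]
  linarith

/-- **THE EXACT SATURATED VALUE**: beyond the saturation height (`2δ + 3G + e ≤ 3m`; `0 < e`, `0 ≤ δ`, `R_out ≤ R_in`) the SRM object of the
place keeps EXACTLY the off-label-1 prices plus residues, `SRM_{n+1}(m) = Σ_{k<n} ((k+2)·δ + (k+3)·G + ρ_{k+2}(m))` — every label `j ≥ 2` is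
unlicensed (`deficit_pos_of_saturated`) and contributes its covered part (`covered_eq`), label 1 contributes `0`. The only height dependence
left is in the residues `ρ_j(m) ∈ [0, e−1]`. [cite: DupuyHilado2025, §4.12] [claim: Mochizuki2012, status: disputed] -/
theorem srm_eq_of_saturated (m e δ Rin Rout : ℤ) (he : 0 < e) (hδ : 0 ≤ δ) (hio : Rout ≤ Rin)
    (hsat : 2 * δ + 3 * (Rin - Rout) + e ≤ 3 * m) (n : ℕ) :
    ∑ k ∈ Finset.range (n + 1),
        (if 0 < e * ((((k : ℤ) + 1) ^ 2 * m - ((k : ℤ) + 1) * δ - ((k : ℤ) + 1 + 1) * Rin) / e) + ((k : ℤ) + 1 + 1) * Rout - m then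
          (((k : ℤ) + 1) ^ 2 - 1) * m -
            (e * ((((k : ℤ) + 1) ^ 2 * m - ((k : ℤ) + 1) * δ - ((k : ℤ) + 1 + 1) * Rin) / e) + ((k : ℤ) + 1 + 1) * Rout - m)
        else 0)
      = ∑ k ∈ Finset.range n,
          (((k : ℤ) + 2) * δ + ((k : ℤ) + 3) * (Rin - Rout) + (((k : ℤ) + 2) ^ 2 * m - ((k : ℤ) + 2) * δ - ((k : ℤ) + 3) * Rin) % e) := by
  rw [Finset.sum_range_succ']
  have h0 : ¬ (0 < e * (((((0 : ℕ) : ℤ) + 1) ^ 2 * m - (((0 : ℕ) : ℤ) + 1) * δ - (((0 : ℕ) : ℤ) + 1 + 1) * Rin) / e) + (((0 : ℕ) : ℤ) + 1 + 1) * Rout - m) :=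
    not_lt.mpr (deficit_one_nonpos he hδ hio (((0 : ℕ) : ℤ) + 1) (by norm_num))
  rw [if_neg h0, add_zero]
  apply Finset.sum_congr rfl
  intro k _
  have e1 : ((k + 1 : ℕ) : ℤ) + 1 = (k : ℤ) + 2 := by push_cast; ring
  have e2 : (k : ℤ) + 2 + 1 = (k : ℤ) + 3 := by ring
  rw [e1, e2]
  have hpos := deficit_pos_of_saturated (m := m) (Rin := Rin) (Rout := Rout) (j := (k : ℤ) + 2) he hδ hio (by omega) hsat
  rw [e2] at hpos
  rw [if_pos hpos]
  have hc := covered_eq m e δ Rin Rout ((k : ℤ) + 2)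
  rw [e2] at hc
  exact hc

/-- **LOWER BRACKET BEYOND SATURATION**: `3n(n+3)·δ + 3n(n+5)·G ≤ 6·SRM_{n+1}(m)` once `2δ + 3G + e ≤ 3m` (`0 < e`, `0 ≤ δ`, `R_out ≤ R_in`) —
with `srm_le` the SRM object of the place is pinned in the height-free band `[3n(n+3)δ + 3n(n+5)G, (same) + 6n(e−1)]/6` at EVERY height past
saturation: it neither grows nor decays with the height. [cite: DupuyHilado2025, §4.12] [claim: Mochizuki2012, status: disputed] -/
theorem le_srm_of_saturated (m e δ Rin Rout : ℤ) (he : 0 < e) (hδ : 0 ≤ δ) (hio : Rout ≤ Rin)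
    (hsat : 2 * δ + 3 * (Rin - Rout) + e ≤ 3 * m) (n : ℕ) :
    3 * (n : ℤ) * (n + 3) * δ + 3 * (n : ℤ) * (n + 5) * (Rin - Rout) ≤
      6 * ∑ k ∈ Finset.range (n + 1),
        (if 0 < e * ((((k : ℤ) + 1) ^ 2 * m - ((k : ℤ) + 1) * δ - ((k : ℤ) + 1 + 1) * Rin) / e) + ((k : ℤ) + 1 + 1) * Rout - m then
          (((k : ℤ) + 1) ^ 2 - 1) * m -
            (e * ((((k : ℤ) + 1) ^ 2 * m - ((k : ℤ) + 1) * δ - ((k : ℤ) + 1 + 1) * Rin) / e) + ((k : ℤ) + 1 + 1) * Rout - m)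
        else 0) := by
  rw [srm_eq_of_saturated m e δ Rin Rout he hδ hio hsat n, ← six_mul_sum_range_price δ (Rin - Rout) n]
  have hle : ∑ k ∈ Finset.range n, (((k : ℤ) + 2) * δ + ((k : ℤ) + 3) * (Rin - Rout)) ≤
      ∑ k ∈ Finset.range n,
        (((k : ℤ) + 2) * δ + ((k : ℤ) + 3) * (Rin - Rout) + (((k : ℤ) + 2) ^ 2 * m - ((k : ℤ) + 2) * δ - ((k : ℤ) + 3) * Rin) % e) := by
    apply Finset.sum_le_sum
    intro k _
    have h0 := Int.emod_nonneg (((k : ℤ) + 2) ^ 2 * m - ((k : ℤ) + 2) * δ - ((k : ℤ) + 3) * Rin) he.ne'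
    linarith
  linarith

/-- **The place's trivial mass is linear in the height**: `6·MASS_{n+1}(m) = ((n+1)(n+2)(2n+3) − 6(n+1))·m` (this seat's
`RealisableMass.six_mul_sum_range_demand` at `L = n+1`). [folklore] -/
theorem six_mul_mass (m : ℤ) (n : ℕ) :
    6 * ∑ k ∈ Finset.range (n + 1), ((((k : ℤ) + 1) ^ 2 - 1) * m) = (((n : ℤ) + 1) * (n + 2) * (2 * n + 3) - 6 * (n + 1)) * m := by
  rw [six_mul_sum_range_demand m (n + 1)]
  push_cast
  ring

/-! ## §3. The exponent: `SRM/MASS = Θ(1/m)` with explicit height-free constants -/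

/-- **HEIGHT EXPONENT `−1`, UPPER SIDE, AT EVERY HEIGHT** (over `ℚ`; `0 < e`, `0 ≤ δ`, `R_out ≤ R_in`, `1 ≤ n`, `0 < m`): with
`S := (n+1)(n+2)(2n+3) − 6(n+1) > 0` and `B := 3n(n+3)δ + 3n(n+5)G + 6n(e−1)`, the recovered fraction of the SRM class at the place obeys
`SRM_{n+1}(m) / MASS_{n+1}(m) ≤ B / (S·m)` — a height-free constant times `m⁻¹`. [cite: DupuyHilado2025, §4.12] [claim: Mochizuki2012, status: disputed] -/
theorem srm_div_mass_le (m e δ Rin Rout : ℤ) (he : 0 < e) (hδ : 0 ≤ δ) (hio : Rout ≤ Rin) (n : ℕ) (hn : 1 ≤ n) (hm : 0 < m) :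
    ((∑ k ∈ Finset.range (n + 1),
        (if 0 < e * ((((k : ℤ) + 1) ^ 2 * m - ((k : ℤ) + 1) * δ - ((k : ℤ) + 1 + 1) * Rin) / e) + ((k : ℤ) + 1 + 1) * Rout - m then
          (((k : ℤ) + 1) ^ 2 - 1) * m -
            (e * ((((k : ℤ) + 1) ^ 2 * m - ((k : ℤ) + 1) * δ - ((k : ℤ) + 1 + 1) * Rin) / e) + ((k : ℤ) + 1 + 1) * Rout - m)
        else 0) : ℤ) : ℚ) / ((∑ k ∈ Finset.range (n + 1), ((((k : ℤ) + 1) ^ 2 - 1) * m) : ℤ) : ℚ)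
      ≤ ((3 * (n : ℤ) * (n + 3) * δ + 3 * (n : ℤ) * (n + 5) * (Rin - Rout) + 6 * (n : ℤ) * (e - 1) : ℤ) : ℚ) /
          (((((n : ℤ) + 1) * (n + 2) * (2 * n + 3) - 6 * (n + 1)) * m : ℤ) : ℚ) := by
  have hup := srm_le m e δ Rin Rout he hδ hio n
  have hmass := six_mul_mass m n
  have hS : 0 < ((n : ℤ) + 1) * (n + 2) * (2 * n + 3) - 6 * (n + 1) := by
    have hn' : (0 : ℤ) < n := by exact_mod_cast hn
    have hfac : ((n : ℤ) + 1) * (n + 2) * (2 * n + 3) - 6 * (n + 1) = ((n : ℤ) + 1) * n * (2 * n + 7) := by ring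
    rw [hfac]
    positivity
  have hSm : (0 : ℚ) < (((((n : ℤ) + 1) * (n + 2) * (2 * n + 3) - 6 * (n + 1)) * m : ℤ) : ℚ) := by
    exact_mod_cast mul_pos hS hm
  set SRM : ℤ := ∑ k ∈ Finset.range (n + 1),
        (if 0 < e * ((((k : ℤ) + 1) ^ 2 * m - ((k : ℤ) + 1) * δ - ((k : ℤ) + 1 + 1) * Rin) / e) + ((k : ℤ) + 1 + 1) * Rout - m then
          (((k : ℤ) + 1) ^ 2 - 1) * m -
            (e * ((((k : ℤ) + 1) ^ 2 * m - ((k : ℤ) + 1) * δ - ((k : ℤ) + 1 + 1) * Rin) / e) + ((k : ℤ) + 1 + 1) * Rout - m)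
        else 0) with hSRM
  set MASS : ℤ := ∑ k ∈ Finset.range (n + 1), ((((k : ℤ) + 1) ^ 2 - 1) * m) with hMASS
  have hM6 : ((MASS : ℤ) : ℚ) = (((((n : ℤ) + 1) * (n + 2) * (2 * n + 3) - 6 * (n + 1)) * m : ℤ) : ℚ) / 6 := by
    rw [eq_div_iff (by norm_num : (6 : ℚ) ≠ 0)]
    exact_mod_cast (by rw [mul_comm]; exact hmass)
  rw [hM6, div_div_eq_mul_div, div_le_div_iff_of_pos_right hSm]
  have hup' : SRM * 6 ≤ 3 * (n : ℤ) * (n + 3) * δ + 3 * (n : ℤ) * (n + 5) * (Rin - Rout) + 6 * (n : ℤ) * (e - 1) := by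
    linarith [hup]
  exact_mod_cast hup'

/-- **HEIGHT EXPONENT `−1`, LOWER SIDE, BEYOND SATURATION** (over `ℚ`; `0 < e`, `0 ≤ δ`, `R_out ≤ R_in`, `1 ≤ n`, `2δ + 3G + e ≤ 3m`): with
`S := (n+1)(n+2)(2n+3) − 6(n+1)` and `A := 3n(n+3)δ + 3n(n+5)G`, `A / (S·m) ≤ SRM_{n+1}(m) / MASS_{n+1}(m)`. With `srm_div_mass_le`: the
recovered fraction of the SRM class is `Θ(m⁻¹)` — exponent EXACTLY `−1` in the height, constants `A/S ≤ B/S` height-free (they differ by the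
residue band `6n(e−1)/S`). [cite: DupuyHilado2025, §4.12] [claim: Mochizuki2012, status: disputed] -/
theorem le_srm_div_mass_of_saturated (m e δ Rin Rout : ℤ) (he : 0 < e) (hδ : 0 ≤ δ) (hio : Rout ≤ Rin) (n : ℕ) (hn : 1 ≤ n)
    (hsat : 2 * δ + 3 * (Rin - Rout) + e ≤ 3 * m) :
    ((3 * (n : ℤ) * (n + 3) * δ + 3 * (n : ℤ) * (n + 5) * (Rin - Rout) : ℤ) : ℚ) /
          (((((n : ℤ) + 1) * (n + 2) * (2 * n + 3) - 6 * (n + 1)) * m : ℤ) : ℚ)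
      ≤ ((∑ k ∈ Finset.range (n + 1),
        (if 0 < e * ((((k : ℤ) + 1) ^ 2 * m - ((k : ℤ) + 1) * δ - ((k : ℤ) + 1 + 1) * Rin) / e) + ((k : ℤ) + 1 + 1) * Rout - m then
          (((k : ℤ) + 1) ^ 2 - 1) * m -
            (e * ((((k : ℤ) + 1) ^ 2 * m - ((k : ℤ) + 1) * δ - ((k : ℤ) + 1 + 1) * Rin) / e) + ((k : ℤ) + 1 + 1) * Rout - m)
        else 0) : ℤ) : ℚ) / ((∑ k ∈ Finset.range (n + 1), ((((k : ℤ) + 1) ^ 2 - 1) * m) : ℤ) : ℚ) := by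
  have hlo := le_srm_of_saturated m e δ Rin Rout he hδ hio hsat n
  have hmass := six_mul_mass m n
  have hm : 0 < m := by omega
  have hS : 0 < ((n : ℤ) + 1) * (n + 2) * (2 * n + 3) - 6 * (n + 1) := by
    have hn' : (0 : ℤ) < n := by exact_mod_cast hn
    have hfac : ((n : ℤ) + 1) * (n + 2) * (2 * n + 3) - 6 * (n + 1) = ((n : ℤ) + 1) * n * (2 * n + 7) := by ring
    rw [hfac]
    positivity
  have hSm : (0 : ℚ) < (((((n : ℤ) + 1) * (n + 2) * (2 * n + 3) - 6 * (n + 1)) * m : ℤ) : ℚ) := by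
    exact_mod_cast mul_pos hS hm
  set SRM : ℤ := ∑ k ∈ Finset.range (n + 1),
        (if 0 < e * ((((k : ℤ) + 1) ^ 2 * m - ((k : ℤ) + 1) * δ - ((k : ℤ) + 1 + 1) * Rin) / e) + ((k : ℤ) + 1 + 1) * Rout - m then
          (((k : ℤ) + 1) ^ 2 - 1) * m -
            (e * ((((k : ℤ) + 1) ^ 2 * m - ((k : ℤ) + 1) * δ - ((k : ℤ) + 1 + 1) * Rin) / e) + ((k : ℤ) + 1 + 1) * Rout - m)
        else 0) with hSRM
  set MASS : ℤ := ∑ k ∈ Finset.range (n + 1), ((((k : ℤ) + 1) ^ 2 - 1) * m) with hMASS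
  have hM6 : ((MASS : ℤ) : ℚ) = (((((n : ℤ) + 1) * (n + 2) * (2 * n + 3) - 6 * (n + 1)) * m : ℤ) : ℚ) / 6 := by
    rw [eq_div_iff (by norm_num : (6 : ℚ) ≠ 0)]
    exact_mod_cast (by rw [mul_comm]; exact hmass)
  rw [hM6, div_div_eq_mul_div, div_le_div_iff_of_pos_right hSm]
  have hlo' : 3 * (n : ℤ) * (n + 3) * δ + 3 * (n : ℤ) * (n + 5) * (Rin - Rout) ≤ SRM * 6 := by
    linarith [hlo]
  exact_mod_cast hlo'

/-! ## §4. Bed witness: the HEX `λ₈@l=11` K-line place at `p = 7` (`e = 165`, `m_q = 120`, `δ = 164`, `R_in = 28`, `R_out = −281`, `L = 5`) -/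

/-- AT THE BED (`m = 120`, `s = 1`): only label 5 is unlicensed; `SRM = 2706` (`= 5·164 + 6·309 + ρ_5`, `ρ_5 = 32`), `MASS = 6000`
(ratio `0.451`). [folklore] -/
example :
    (∑ k ∈ Finset.range (4 + 1),
        (if 0 < (165 : ℤ) * ((((k : ℤ) + 1) ^ 2 * 120 - ((k : ℤ) + 1) * 164 - ((k : ℤ) + 1 + 1) * 28) / 165) + ((k : ℤ) + 1 + 1) * (-281) - 120 then
          (((k : ℤ) + 1) ^ 2 - 1) * 120 -
            ((165 : ℤ) * ((((k : ℤ) + 1) ^ 2 * 120 - ((k : ℤ) + 1) * 164 - ((k : ℤ) + 1 + 1) * 28) / 165) + ((k : ℤ) + 1 + 1) * (-281) - 120)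
        else 0)) = 2706 ∧
    (∑ k ∈ Finset.range (4 + 1), ((((k : ℤ) + 1) ^ 2 - 1) * (120 : ℤ))) = 6000 := by
  decide

/-- SATURATION AT `s = 4` (`m = 480`): the threshold `2δ + 3G + e = 328 + 927 + 165 = 1420 ≤ 1440 = 3·480` holds, every label `2 … 5` is
unlicensed, `SRM(480) = 8208` lies in the height-free band `[7858, 8514]` (`= [3·4·7·164 + 3·4·9·309, (same) + 6·4·164]/6`), `MASS = 24000`
(ratio `0.342`). [folklore] -/
example :
    2 * (164 : ℤ) + 3 * (28 - (-281)) + 165 ≤ 3 * 480 ∧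
    (∑ k ∈ Finset.range (4 + 1),
        (if 0 < (165 : ℤ) * ((((k : ℤ) + 1) ^ 2 * 480 - ((k : ℤ) + 1) * 164 - ((k : ℤ) + 1 + 1) * 28) / 165) + ((k : ℤ) + 1 + 1) * (-281) - 480 then
          (((k : ℤ) + 1) ^ 2 - 1) * 480 -
            ((165 : ℤ) * ((((k : ℤ) + 1) ^ 2 * 480 - ((k : ℤ) + 1) * 164 - ((k : ℤ) + 1 + 1) * 28) / 165) + ((k : ℤ) + 1 + 1) * (-281) - 480)
        else 0)) = 8208 ∧
    3 * (4 : ℤ) * (4 + 3) * 164 + 3 * 4 * (4 + 5) * (28 - (-281)) = 6 * 7858 ∧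
    3 * (4 : ℤ) * (4 + 3) * 164 + 3 * 4 * (4 + 5) * (28 - (-281)) + 6 * 4 * (165 - 1) = 6 * 8514 ∧
    (∑ k ∈ Finset.range (4 + 1), ((((k : ℤ) + 1) ^ 2 - 1) * (480 : ℤ))) = 24000 := by
  decide

/-- AT `s = 100` (`m = 12000`): `SRM = 8238` (still in `[7858, 8514]`), `MASS = 600000` — the SRM object is pinned while the mass grew
`×100`: ratio `0.0137 = (0.342·4)/100` to two digits, i.e. exponent `−1`. [folklore] -/
example :
    (∑ k ∈ Finset.range (4 + 1),
        (if 0 < (165 : ℤ) * ((((k : ℤ) + 1) ^ 2 * 12000 - ((k : ℤ) + 1) * 164 - ((k : ℤ) + 1 + 1) * 28) / 165) + ((k : ℤ) + 1 + 1) * (-281) - 12000 then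
          (((k : ℤ) + 1) ^ 2 - 1) * 12000 -
            ((165 : ℤ) * ((((k : ℤ) + 1) ^ 2 * 12000 - ((k : ℤ) + 1) * 164 - ((k : ℤ) + 1 + 1) * 28) / 165) + ((k : ℤ) + 1 + 1) * (-281) - 12000)
        else 0)) = 8238 ∧
    (∑ k ∈ Finset.range (4 + 1), ((((k : ℤ) + 1) ^ 2 - 1) * (12000 : ℤ))) = 600000 := by
  decide

/-- The saturated band of this place as an instance of the general theorems (`n = 4`): `6·7858 ≤ 6·SRM(480) ≤ 6·8514`. [folklore] -/
example :
    3 * ((4 : ℕ) : ℤ) * ((4 : ℕ) + 3) * 164 + 3 * ((4 : ℕ) : ℤ) * ((4 : ℕ) + 5) * (28 - (-281)) ≤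
      6 * ∑ k ∈ Finset.range (4 + 1),
        (if 0 < (165 : ℤ) * ((((k : ℤ) + 1) ^ 2 * 480 - ((k : ℤ) + 1) * 164 - ((k : ℤ) + 1 + 1) * 28) / 165) + ((k : ℤ) + 1 + 1) * (-281) - 480 then
          (((k : ℤ) + 1) ^ 2 - 1) * 480 -
            ((165 : ℤ) * ((((k : ℤ) + 1) ^ 2 * 480 - ((k : ℤ) + 1) * 164 - ((k : ℤ) + 1 + 1) * 28) / 165) + ((k : ℤ) + 1 + 1) * (-281) - 480)
        else 0) ∧
    6 * ∑ k ∈ Finset.range (4 + 1),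
        (if 0 < (165 : ℤ) * ((((k : ℤ) + 1) ^ 2 * 480 - ((k : ℤ) + 1) * 164 - ((k : ℤ) + 1 + 1) * 28) / 165) + ((k : ℤ) + 1 + 1) * (-281) - 480 then
          (((k : ℤ) + 1) ^ 2 - 1) * 480 -
            ((165 : ℤ) * ((((k : ℤ) + 1) ^ 2 * 480 - ((k : ℤ) + 1) * 164 - ((k : ℤ) + 1 + 1) * 28) / 165) + ((k : ℤ) + 1 + 1) * (-281) - 480)
        else 0)
      ≤ 3 * ((4 : ℕ) : ℤ) * ((4 : ℕ) + 3) * 164 + 3 * ((4 : ℕ) : ℤ) * ((4 : ℕ) + 5) * (28 - (-281)) + 6 * ((4 : ℕ) : ℤ) * (165 - 1) :=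
  ⟨le_srm_of_saturated 480 165 164 28 (-281) (by norm_num) (by norm_num) (by norm_num) (by norm_num) 4,
   srm_le 480 165 164 28 (-281) (by norm_num) (by norm_num) (by norm_num) 4⟩

end Summit.ABC.IUTFork.Repair.RH.HeightScalingSRM
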